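import Summits.BirchSwinnertonDyer.BirchSwinnertonDyer.Theorems.ManinLocalTwoThreeShimuraSectorRankLaw
import HarnessLib

/-!
# The sector laws at square level, RETYPED after the numerical refutation of the all-`ℓ` laws (imc g44, MEMO-imc §57; T-imc-60)

Cell bsd-f2-manin, route `ManinLocalTwoThree`, crux C3 `ManinPrimeToThreeAtNine` (stmt-BirchSwinnertonDyer-22968) / C2 (stmt-22967); imc g44's
`HOME/imc/g44/Sketch60.lean` 8e582f9b42f6f52b landed verbatim by LEAD p1 g26 as a new module (`--supports stmt-BirchSwinnertonDyer-22968`, helper).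
HONEST FRAMING: five `@[conjecture]` TYPED CANDIDATES (obligation schemata with census witnesses), no theorem about C2/C3; nothing here
proves Manin's conjecture or BSD.

`SectorRankLawWWE` (§8 of `…ShimuraSectorTame`) and `SectorRankLawUnified` (§9 of `…ShimuraSectorRankLaw`) are refuted
numerically at `(2783, 11, 23)`, `(5225, 5, 11)`, `(7975, 5, 11)` (tame) and `(2375, 5, 5)` (wild) — law value `1`, engine `2`
(ref1 §R316/§R319, kit j343182/j343181).  They stay in the tree as negative edges.  This sketch types:

* `SectorRankLawWWEAtThree`, `SectorRankLawUnifiedAtThree` — the honest restatements (`ℓ = 3`; census 139/139 + P-4095);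
* `SquareLevelEisensteinPairLaw` (LAW 57.L) — the universal `ℓ²`-new Eisenstein PAIR at every level `ℓ² q` (`ℓ ≥ 5`,
  `q² ≢ 1 (mod ℓ)`): the mechanism behind the `ℓ ≥ 5` base term (census 14/14 levels, two `T_p`-depths);
* `MinusMinusSectorLaw` (LAW 57.M) — the `(−,−)` sector at tame pure `ℓ² q₀` is a line iff `ℓ² ∣ q₀ − 1` (census 9/9);
* `TamePureSectorBound` (LAW 57.B′) — at tame pure `ℓ² q₀`, `ℓ ≥ 5`, the `E_χ`-sector has dimension `1` or `2`
  (= old line + at most one lifted new class; census 9/9 pure + 3479).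
No `sorry`; statements only.
-/

set_option autoImplicit false
-- lint-debt: the directory name repeats the summit name (sibling precedent `ManinLocalTwoThreeShimuraSectorRankLaw.lean`)
set_option linter.dupNamespace false

namespace Summit.BirchSwinnertonDyer.BirchSwinnertonDyer.Theorems.ManinLocalTwoThree.ShimuraSector

/-- **RESTATEMENT (imc g44, §57.1): LAW 54.M′ at `ℓ = 3` only.**  `SectorRankLawWWE` with `ℓ = 3`; census 139/139 tame habitat
rows `N ≤ 3200` (ref1 §R311/§R313/§R316, kit j342887/j342908/j342937/j343182) + P-4095 (habitat-excluded, THEOREM 55.B HIT,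
j343181).  The all-`ℓ` form is refuted at `(5225, 5, 11)`, `(7975, 5, 11)` (law `1`, engine `2`, j343181) and `(2783, 11, 23)` (j343182).
[cite: WakeWangErickson2021, Thm. 1.5.1] -/
@[conjecture]
def SectorRankLawWWEAtThree (N q₀ : ℕ) [NeZero N] (χ₀ : ZMod q₀ → ZMod 3) (S : Finset ℕ) : Prop :=
  SectorRankLawWWE N 3 q₀ χ₀ S

/-- **RESTATEMENT (imc g44, §57.1): LAW 55.U at `ℓ = 3` only.**  `SectorRankLawUnified` with `ℓ = 3` (tame AND wild `b = 3`);
census: every `ℓ = 3` row of TABLE-55T / SECTORS-j342908 / j343182 / j343181 (`N ≤ 3200` complete + 4095), 0 misses.  The all-`ℓ`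
form is refuted at `(2783, 11, 23)`, `(5225, 5, 11)`, `(7975, 5, 11)` and the wild `(2375, 5, 5)` (law `1`, engine `2`).
[cite: WakeWangErickson2021, Thm. 1.5.1] [cite: Mazur1977, II.16–II.18] -/
@[conjecture]
def SectorRankLawUnifiedAtThree (N b : ℕ) [NeZero N] (S : Finset ℕ) : Prop :=
  SectorRankLawUnified N 3 b S

/-- **LAW 57.L — THE `ℓ²`-NEW EISENSTEIN PAIR (imc g44, MEMO-imc §57.3; CONJECTURE with a printed existence half).**
For a prime `ℓ ≥ 5` and a prime `q ≠ ℓ` with `q² ≢ 1 (mod ℓ)`, at `N = ℓ² q` the Eisenstein sector of signs `W_{ℓ²} = +1`,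
`W_q = −1` with `U_ℓ = 0`, `T_p ≡ 1 + p` (`p ≤ 13`, `p ∉ {ℓ, q}`), star-even and NO `U_q`-condition is a LINE over `𝔽_ℓ`
(its generator has `U_q = 1`, i.e. it is the reduction of a `q`-new, `ℓ²`-new eigenclass; with its star-odd partner it is a
pair `(1,1)`; the levels `ℓ q`, `ℓ²`, `q` contribute nothing).  Existence half in print: the rational cuspidal divisor
`C_N = (0) − (∞)` of `X₀(ℓ² q)` has order `κ(N)/24 · (corrections prime to ℓ)`, `κ(ℓ² q) = ℓ (ℓ² − 1)(q² − 1)` — divisible by `ℓ`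
exactly because `ℓ² ∣ N` (Ligozat; Yoo, arXiv:1908.06411, §1.2 and Thm. 1.5/1.7; Lorenzini 1995 for prime-power level), so
`J₀(ℓ² q)(ℚ)` has an Eisenstein point of order `ℓ` new at `ℓ²`.  Multiplicity ONE (the `= 1`) and the sign/`U` profile are the
conjectural part.  Census (BC5 witness, imc g44 engine `mult60.py`, parabolic cohomology mod `ℓ`, `T_p` for `p ≤ 23` AND for
`p ≤ 13`): `(ℓ, q)` = (5,2) 50, (5,3) 75, (5,7) 175, (5,13) 325, (5,17) 425, (5,23) 575, (7,2) 98, (7,3) 147, (7,5) 245, (7,11) 539,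
(11,2) 242, (11,3) 363, (13,2) 338, (13,3) 507 — 14/14 (the last five pre-registered before running); out of habitat it also holds
at (5,19) 475 (`q ≡ −1`) and (5,11) 275 (`q ≡ 1`, where the line is OLD), and FAILS at (11,23) 2783 (dimension 2).
Why it might fail: a second, sporadic `(1 ⊕ ω)`-congruent newform at some `ℓ² q` (non-Gorenstein new Hecke algebra) gives `2`.
[cite: Lorenzini1995] [cite: Yoo2023, Thm. 1.5, Thm. 1.7] [cite: Mazur1977, II.9] -/
@[conjecture]
def SquareLevelEisensteinPairLaw (N ℓ q : ℕ) [NeZero N] [Fact ℓ.Prime] (S : Finset ℕ) : Prop :=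
  N = ℓ ^ 2 * q → 5 ≤ ℓ → q.Prime → q ≠ ℓ → q ^ 2 % ℓ ≠ 1 →
    (∀ p : ℕ, p.Prime → (p ≤ 13 ∨ p = ℓ) → p ≠ q → p ∈ S) → q ∉ S →
      Module.finrank (ZMod ℓ) ↥(sectorSubmodule N (ZMod ℓ) S (exactPrimePowerDivisors N) (diamondSign (ZMod ℓ) q)) = 1

/-- **LAW 57.M — THE `(−,−)` SECTOR AT TAME PURE LEVEL (imc g44, MEMO-imc §57.4; CONJECTURE).**  For `ℓ ≥ 5`, `q₀ ≡ 1 (mod ℓ)`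
prime, `N = ℓ² q₀`, `S ⊇ {p ≤ 13} ∪ {ℓ, q₀}` (so `U_ℓ = 0` and `U_{q₀} = q₀ ≡ 1` are imposed): the Eisenstein sector with BOTH
Atkin–Lehner signs `−1` is a line if `ℓ² ∣ q₀ − 1` and is `0` otherwise.  Mechanism (§57.4): the principal-series newforms
`F′ ⊗ ψ^{±1}` (`ψ` of order `ℓ` and conductor `q₀`… transported to conductor `ℓ²`) congruent to `1 ⊕ ω` exist iff `ℓ² ∣ q₀ − 1`
and have `w_{ℓ²} = −1`.  Census (ref1 SECTORS-j342908/j343182, column `T+U+W`, signs `(−1,−1)`): 275, 775, 1025, 1525, 1775,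
1421, 2107, 2783 → `0`; 2525 (`25 ∣ 100`) → `2 = (1,1)`, star-even part `1` — 9/9.  Why it might fail: a supercuspidal-type
congruent newform with `w_{ℓ²} = −1 = w_{q₀}` at some pure level would add a line although `ℓ² ∤ q₀ − 1`.
[cite: Mazur1977, II.9] [cite: WakeWangErickson2021, Thm. 1.5.1] -/
@[conjecture]
def MinusMinusSectorLaw (N ℓ q₀ : ℕ) [NeZero N] [Fact ℓ.Prime] (S : Finset ℕ) : Prop :=
  N = ℓ ^ 2 * q₀ → 5 ≤ ℓ → q₀.Prime → q₀ % ℓ = 1 → (∀ p : ℕ, p.Prime → (p ≤ 13 ∨ p ∣ N) → p ∈ S) →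
    Module.finrank (ZMod ℓ) ↥(sectorSubmodule N (ZMod ℓ) S (exactPrimePowerDivisors N) (fun _ => (-1 : ZMod ℓ))) =
      if ℓ ^ 2 ∣ q₀ - 1 then 1 else 0

/-- **LAW 57.B′ — TAME PURE BOUND (imc g44, MEMO-imc §57.5; CONJECTURE; the honest `ℓ ≥ 5` replacement of the refuted
`= 1`).**  For `ℓ ≥ 5`, `q₀ ≡ 1 (mod ℓ)` prime, `N = ℓ² q₀`, `S ⊇ {p ≤ 13} ∪ {ℓ, q₀}`: the `E_χ`-sector (signs `W_{ℓ²} = +1`,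
`W_{q₀} = −1`) has dimension `1` or `2`.  Structure (§57.2–§57.3, paper proof + engine): the `ℓ`-old part of the sector is the
line `β α₀ (sector at level q₀)` (degeneracy-kernel saturation + `ker U_ℓ = β`-image), and the `ℓ`-new quotient carries exactly
one `𝔪`-pair `(1,1)` in these signs (LAW 57.L transported; measured `(1,1)` at 275 and 475 in the quotient `H¹/(α,β)H¹(ℓ q₀)`),
of which the star-even class lifts to `H¹[𝔪]` or not: `1 + lift`, `lift ∈ {0,1}`.  Census: 275, 775, 1025, 1525, 1775, 2525,
1421, 2107, 3479 → `1` (`lift = 0`); 2783 → `2` (`lift = 1`, the extra class `ℓ²`-new: ref1 J-B1 j343343) — 10/10.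
Pre-registered deciders for the lift RULE (not for this bound): 8107 = 121·67 and 8957 = 169·53 (ref1 j343343, pending).
Why it might fail: two independent lifting new classes (`lift = 2`) at a pure level with a non-Gorenstein new Hecke algebra.
[cite: Mazur1977, II.16–II.18] [cite: Ribet1984ICM, Thm. 4.1] -/
@[conjecture]
def TamePureSectorBound (N ℓ q₀ : ℕ) [NeZero N] [Fact ℓ.Prime] (S : Finset ℕ) : Prop :=
  N = ℓ ^ 2 * q₀ → 5 ≤ ℓ → q₀.Prime → q₀ % ℓ = 1 → (∀ p : ℕ, p.Prime → (p ≤ 13 ∨ p ∣ N) → p ∈ S) →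
    Module.finrank (ZMod ℓ) ↥(sectorSubmodule N (ZMod ℓ) S (exactPrimePowerDivisors N) (diamondSign (ZMod ℓ) q₀)) ∈
      ({1, 2} : Finset ℕ)

/-- Arithmetic side of LAW 57.L's habitat at the 14 census pairs and the three out-of-habitat pairs (kernel-decidable). [folklore] -/
example : (([(5,2),(5,3),(5,7),(5,13),(5,17),(5,23),(7,2),(7,3),(7,5),(7,11),(11,2),(11,3),(13,2),(13,3)] : List (ℕ × ℕ)).all
    fun lq => decide (5 ≤ lq.1) && decide (lq.2 ≠ lq.1) && decide (lq.2 ^ 2 % lq.1 ≠ 1)) = true := by decide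

example : (([(5,19),(5,11),(11,23)] : List (ℕ × ℕ)).all fun lq => decide (lq.2 ^ 2 % lq.1 = 1)) = true := by decide

/-- Arithmetic side of LAW 57.M at the nine pure census rows: `ℓ² ∣ q₀ − 1` exactly at `(5, 101)`. [folklore] -/
example : (([(5,11),(5,31),(5,41),(5,61),(5,71),(7,29),(7,43),(11,23)] : List (ℕ × ℕ)).all
    fun lq => decide (lq.2 % lq.1 = 1) && !decide (lq.1 ^ 2 ∣ lq.2 - 1)) = true ∧ (5 ^ 2 ∣ 101 - 1) := by decide

end Summit.BirchSwinnertonDyer.BirchSwinnertonDyer.Theorems.ManinLocalTwoThree.ShimuraSector
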